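import Mathlib
import Summits.CriticalPhenomena.Ising3DConformalLimit.Theses.PrecisionLaplacian
import Summits.CriticalPhenomena.Ising3DConformalLimit.Theses.PrimaryAtInfinity

/-!
# Sketch — crux stmt-CriticalPhenomena-4801 `MoebiusLimitOfTwoPointLaw` (crux-ideate, ideator 2)

First lemmas of the two idea cards, stated over existing declarations, plus a
kernel-checked composition for each card showing the stated stubs reach the crux BY NAME.
No new axioms; every open statement is a `def … : Prop` used as a hypothesis.
-/

namespace Summit.CriticalPhenomena.Ising3DConformalLimit.Cruxes.MoebiusLimitOfTwoPointLaw.Sketch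

open Literature.Probability.LatticeModels

/-- Points of `ℝ³`. -/
abbrev E3 : Type := EuclideanSpace ℝ (Fin 3)

/-! ## Card A — two-shell exchange hierarchy -/

/-- Covariance of a family under the inversion in the sphere of radius `√λ` centred at `0`
(`x ↦ λ x/‖x‖²`, conformal factor `λ/‖x‖²`), with weight `Δ` per point. These maps, `λ > 0`,
together generate the unit inversion and all dilations. -/
def IsSphereInversionCovariant (Δ : ℝ) (S : CorrFamily 3) : Prop :=
  ∀ (n : ℕ) (lam : ℝ), 0 < lam → ∀ x : Fin n → E3, (∀ i, x i ≠ 0) →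
    S n (fun i => (lam / ‖x i‖ ^ 2) • x i)
      = lam ^ (-(n : ℝ) * Δ) * (∏ i, ‖x i‖ ^ (2 * Δ)) * S n x

/-- The TWO-SHELL EXCHANGE LAW `E_{k,m}`: for unit directions `u i` and a marking `inner i` of which
points sit on the inner sphere (radius `a`) and which on the outer one (radius `b`), exchanging the
radii of the two angular patterns multiplies `S_n` by `(a/b)^{(k-m)Δ}` (`k` inner, `m` outer points);
weight-free when `k = m`. This is `IsSphereInversionCovariant` read on configurations supported by
two concentric spheres (`λ = ab`). -/
def TwoShellExchange (Δ : ℝ) (S : CorrFamily 3) : Prop :=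
  ∀ (n : ℕ) (a b : ℝ), 0 < a → 0 < b → ∀ (u : Fin n → E3) (inner : Fin n → Bool),
    (∀ i, ‖u i‖ = 1) →
      S n (fun i => (if inner i then b else a) • u i)
        = (a / b) ^ ((((Finset.univ.filter fun i => inner i = true).card : ℝ)
              - ((Finset.univ.filter fun i => inner i = false).card : ℝ)) * Δ)
          * S n (fun i => (if inner i then a else b) • u i)

/-- First lemma A1 (kinematics, provable now): scale covariance + unit-inversion covariance give
covariance under every origin-centred sphere inversion. -/
def KinematicNecessity : Prop :=
  ∀ (Δ : ℝ) (S : CorrFamily 3), IsScaleCovariant Δ S → IsInversionCovariant Δ S →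
    IsSphereInversionCovariant Δ S

/-- First lemma A2 (provable now): sphere-inversion covariance implies the two-shell exchange law. -/
def SphereInversionGivesExchange : Prop :=
  ∀ (Δ : ℝ) (S : CorrFamily 3), IsSphereInversionCovariant Δ S → TwoShellExchange Δ S

/-- First lemma A3 (provable now, one line of algebra: `‖b u - a v‖ = ‖a u - b v‖` for unit `u, v`):
the `(1,1)` member of the hierarchy IS the two-point isotropic pure power law — the conclusion that
the crux hypothesis (item 0634) forces on every pointwise scaling limit. -/
def BaseCaseFromTwoPointLaw : Prop :=
  ∀ (c Δ : ℝ) (S : CorrFamily 3),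
    (∀ a b : E3, a ≠ b → S 2 ![a, b] = c * ‖a - b‖ ^ (-(2 * Δ))) →
      ∀ (a b : ℝ), 0 < a → 0 < b → ∀ (u v : E3), ‖u‖ = 1 → ‖v‖ = 1 → a • u ≠ b • v →
        S 2 ![b • u, a • v] = S 2 ![a • u, b • v]

/-- Group lemma (provable, `L`): a normalised, continuous-off-diagonal, translation-invariant family
that is covariant under every origin-centred sphere inversion is Möbius covariant — dilations are
`ι_λ ∘ ι_1`, and `⟨translations, ι⟩ = Möb(3)` supplies `O(3)` (words of inversion-first /
`PrimaryAtInfinity.WardToMoebius`). -/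
def GroupLemma : Prop :=
  ∀ (Δ : ℝ) (S : CorrFamily 3),
    (∀ n z, z ∉ NonCoincident 3 n → S n z = 0) →
    (∀ n, ContinuousOn (S n) (NonCoincident 3 n)) →
    IsTranslationInvariant S → IsSphereInversionCovariant Δ S → IsMoebiusCovariant Δ S

/-- Two-point identification (analysis, provable): under the crux hypothesis (item 0634) every
pointwise scaling limit of `criticalCorr 3` with `ρ > 0` and non-degenerate two-point function has
`S 2 ![a,b] = c' ‖a-b‖^{-2Δ}` with the SAME `Δ` (and `Δ > 0`), because
`ρ(δ)² δ^{2Δ} → c'/c`. -/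
def TwoPointIdentification : Prop :=
  (∃ Δ c : ℝ, 0 < c ∧ Filter.Tendsto (fun x : Site 3 =>
      criticalTwoPoint 3 x * Real.sqrt (∑ i, ((x i : ℝ)) ^ 2) ^ (2 * Δ)) Filter.cofinite (nhds c)) →
  ∀ (ρ : ℝ → ℝ) (S : CorrFamily 3), (∀ δ ∈ Set.Ioc (0:ℝ) 1, 0 < ρ δ) →
    HasPointwiseScalingLimit (criticalCorr 3) ρ S → IsNondegenerateTwoPoint S →
      ∃ c Δ : ℝ, 0 < c ∧ 0 < Δ ∧ ∀ a b : E3, a ≠ b → S 2 ![a, b] = c * ‖a - b‖ ^ (-(2 * Δ))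

/-- THE CRUX STUB OF CARD A, part (i) — exchangeability of Weyl-rescaled inner/outer traces, in
correlation form: every normalised regular pointwise scaling limit of `criticalCorr 3` whose
two-point function is `c‖a-b‖^{-2Δ}` satisfies the two-shell exchange law with that `Δ`. -/
def ExchangeForIsingLimits : Prop :=
  ∀ (ρ : ℝ → ℝ) (S : CorrFamily 3) (c Δ : ℝ), (∀ δ ∈ Set.Ioc (0:ℝ) 1, 0 < ρ δ) →
    HasPointwiseScalingLimit (criticalCorr 3) ρ S →
    (∀ n z, z ∉ NonCoincident 3 n → S n z = 0) → 0 < c →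
    (∀ a b : E3, a ≠ b → S 2 ![a, b] = c * ‖a - b‖ ^ (-(2 * Δ))) →
      TwoShellExchange Δ S

/-- THE CRUX STUB OF CARD A, part (ii) — the MARKOV LIFT: for Ising limits (whose random-field
avatars inherit the domain-Markov property across spheres, `Δ < 1` making sphere traces honest), the
two-shell exchange law (= symmetry of the two-time law of the stationary sphere chain) lifts to
covariance under every origin-centred sphere inversion (= reversibility of the chain). -/
def MarkovLift : Prop :=
  ∀ (ρ : ℝ → ℝ) (S : CorrFamily 3) (c Δ : ℝ), (∀ δ ∈ Set.Ioc (0:ℝ) 1, 0 < ρ δ) →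
    HasPointwiseScalingLimit (criticalCorr 3) ρ S →
    (∀ n z, z ∉ NonCoincident 3 n → S n z = 0) → 0 < c →
    (∀ a b : E3, a ≠ b → S 2 ![a, b] = c * ‖a - b‖ ^ (-(2 * Δ))) →
      TwoShellExchange Δ S → IsSphereInversionCovariant Δ S

/-- Composition for card A (pure logic, kernel-checked): existence of a regular translation-invariant
limit (`PrimaryAtInfinity.ExistsRegularLimit`, item 5355) + two-point identification + exchange +
Markov lift + group lemma ⇒ the crux `PrecisionLaplacian.MoebiusLimitOfTwoPointLaw` by name. -/
theorem cardA_concludes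
    (hE : Theses.PrimaryAtInfinity.ExistsRegularLimit)
    (hId : TwoPointIdentification)
    (hEx : ExchangeForIsingLimits)
    (hLift : MarkovLift)
    (hGrp : GroupLemma) :
    Theses.PrecisionLaplacian.MoebiusLimitOfTwoPointLaw := by
  intro h0634
  obtain ⟨ρ, S, hρ, hlim, hnorm, hnd, htr, _hpar, hcont⟩ := hE
  obtain ⟨c, Δ, hc, hΔ, hS2⟩ := hId h0634 ρ S hρ hlim hnd
  have hex : TwoShellExchange Δ S := hEx ρ S c Δ hρ hlim hnorm hc hS2
  have hsph : IsSphereInversionCovariant Δ S := hLift ρ S c Δ hρ hlim hnorm hc hS2 hex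
  have hmoeb : IsMoebiusCovariant Δ S := hGrp Δ S hnorm hcont htr hsph
  exact ⟨ρ, Δ, S, hρ, hΔ, hlim, hnd, hmoeb⟩

/-- VERBATIM COPY of `Summit.CriticalPhenomena.Ising3DConformalLimit.Theses.PerfectScreening.NonSaturation`
(item stmt-CriticalPhenomena-1342), inlined only so that this published sketch does not import the
PerfectScreening route file (farm coherence); a holder of the route item converts by `exact h`
(δ-unfolding, identical bodies). -/
def NonSaturationCopy : Prop :=
  ∀ ε : ℝ, 0 < ε → ∃ᶠ n : ℕ in Filter.atTop,
    (n : ℝ) * Literature.Probability.LatticeModels.criticalTwoPoint 3 (Pi.single 0 (n : ℤ)) < ε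

/-! ## Card B — first multipole at infinity (route PrimaryAtInfinity) with the `η > 0` edge
supplied by `PerfectScreening.NonSaturation` (here as the verbatim copy `NonSaturationCopy`) -/

/-- Glue lemma B1 (provable now): the crux hypothesis (item 0634) together with non-saturation of
the infrared bound along one axial sequence (`PerfectScreening.NonSaturation`, item 1342) forces
`Δ > 1/2`: if `Δ ≤ 1/2` then `n · G(n e₁) = (G(ne₁) n^{2Δ}) · n^{1-2Δ} ≥ (c/2) n^{1-2Δ} ≥ c/2`
eventually, contradicting `liminf n G(ne₁) = 0`; and `Δ ≥ 1/2` always (infrared bound). -/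
def StrictEtaFromNonSat : Prop :=
  NonSaturationCopy →
  ∀ Δ c : ℝ, 0 < c →
    Filter.Tendsto (fun x : Site 3 =>
      criticalTwoPoint 3 x * Real.sqrt (∑ i, ((x i : ℝ)) ^ 2) ^ (2 * Δ)) Filter.cofinite (nhds c) →
    1 / 2 < Δ

/-- Glue lemma B2 (analysis, provable): 0634 with `Δ > 1/2` gives route PrimaryAtInfinity's
two-point crux `TwoPointPowerLawEta` (item 5354) for EVERY non-degenerate pointwise limit. -/
def TwoPointLawFeedsPAI : Prop :=
  (∃ Δ c : ℝ, 1 / 2 < Δ ∧ 0 < c ∧ Filter.Tendsto (fun x : Site 3 =>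
      criticalTwoPoint 3 x * Real.sqrt (∑ i, ((x i : ℝ)) ^ 2) ^ (2 * Δ)) Filter.cofinite (nhds c)) →
  Theses.PrimaryAtInfinity.TwoPointPowerLawEta

/-- Composition for card B (pure logic, kernel-checked): PrimaryAtInfinity's cruxes 5352, 5353, 5355
and supports 5356, 5357, plus NonSaturation (1342) and the two glue lemmas, give the crux by name —
a line staffed entirely by EXISTING items except the two small glue lemmas. -/
theorem cardB_concludes
    (hNS : NonSaturationCopy)
    (hB1 : StrictEtaFromNonSat)
    (hB2 : TwoPointLawFeedsPAI)
    (h₁ : Theses.PrimaryAtInfinity.FirstMultipoleIdentity)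
    (h₂ : Theses.PrimaryAtInfinity.FarFieldClustering)
    (h₅ : Theses.PrimaryAtInfinity.ExistsRegularLimit)
    (h₆ : Theses.PrimaryAtInfinity.MultipoleToWard)
    (h₇ : Theses.PrimaryAtInfinity.WardToMoebius) :
    Theses.PrecisionLaplacian.MoebiusLimitOfTwoPointLaw := by
  intro h0634
  obtain ⟨Δ₀, c₀, hc₀, hT⟩ := h0634
  have hΔ₀ : 1 / 2 < Δ₀ := hB1 hNS Δ₀ c₀ hc₀ hT
  have h₃ : Theses.PrimaryAtInfinity.TwoPointPowerLawEta := hB2 ⟨Δ₀, c₀, hΔ₀, hc₀, hT⟩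
  -- from here on: verbatim the deciding theorem of route PrimaryAtInfinity minus clause (iii)
  obtain ⟨ρ, S, hρ, hlim, hnorm, hnd, htr, hpar, hcont⟩ := h₅
  obtain ⟨c, Δ, hc, hΔ, hS2⟩ := h₃ ρ S hρ hlim hnd
  have hward := h₆ S c Δ hc.ne' hcont (fun n => by
    obtain ⟨A₀, A₁, hA, hid⟩ := h₁ ρ S c Δ hρ hlim hnorm hc hS2 (n + 1)
    exact ⟨A₀, A₁, hA, hid, h₂ ρ S c Δ hρ hlim hnorm hc hS2 n A₀ A₁ hA⟩)
  have hmoeb : IsMoebiusCovariant Δ S := h₇ S Δ hnorm hcont htr hpar hward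
  exact ⟨ρ, Δ, S, hρ, by linarith, hlim, hnd, hmoeb⟩

end Summit.CriticalPhenomena.Ising3DConformalLimit.Cruxes.MoebiusLimitOfTwoPointLaw.Sketch
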